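import Mathlib.LinearAlgebra.Matrix.Rank
import Literature.Computability.AlgebraicComplexity.LandsbergRessayre
import HarnessLib

/-!
# Landsberg–Ressayre, Thm. 2.8 — step 1: regularity and the normal form `Λ_{n-1}` (LR17 §3.3)

Topic `Literature/Computability/AlgebraicComplexity`.  First file of the bottom-up proof of the
named fact `lr_left_equivariant_lower` (`LandsbergRessayre.lean`, LR17 Thm. 2.8); the plan (an
elementary reformulation of LR17 §6 in which the only non-elementary input is von zur Gathen's
regularity theorem below) is recorded in the prover's notes.  This file vendors LR17 §3.3:

* `constPart A = Ã(0) = Λ`, the constant part of a matrix of polynomials, and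
  `IsRegularDetRepr` (LR17 Def. 2.12: `rank Ã(0) = n - 1`);
* the NAMED FACT `vonzurGathen1987_perm_detRepr_rank` (von zur Gathen 1987, Thm. 3.1 with §2;
  quoted as LR17 Lemma 3.2 + "codim {perm_m = 0}_sing ≥ 5"): if `det ∘ Ã = perm_m`, `m ≥ 3`, then
  `rank Ã(v) ≥ n - 1` for every point `v` — its proof is dimension theory (fibre dimension and
  vzG Lemma 2.3) and is NOT vendored; proved corollaries: every affine determinantal
  representation of `perm_m` (`m ≥ 3`) over `ℂ` is regular (`isRegularDetRepr_perPoly`);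
* PROVED: in the tree's exact-lift form of equivariance (`IsEquivariantDetRepr`) every lift
  `(g, h)` of a symmetry stabilises `Λ` (`g Λ = Λ h`, LR17 Def. 1.2, automatic here);
* PROVED: LR17 Lemma 3.3 (identity component): the pairs `(P, Q)` with `P Λ_{n-1} = Λ_{n-1} Q` are
  exactly the block pairs `P = [[λ₂, 0], [v₂, g]]`, `Q = [[λ₁, φ₁], [0, g]]` (same `g`);
* PROVED: the normal form: a regular `Λ` is `V⁻¹ Λ_{n-1} U⁻¹` for invertible `V, U`
  (LR17 §3.3, last paragraph), via Mathlib's `Matrix.exists_rank_normal_form`.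

## Plan of the proof of `lr_left_equivariant_lower` (LR17 Thm. 2.8), for orientation

All over `ℂ`, `m ≥ 3`, `Ã = Λ + A₁` equivariant for the left monomial symmetries, `det Ã = perm_m`.
(B0) regularity `rank Λ = n - 1` (this file; von zur Gathen, named fact).  (B1) lifts stabilise `Λ`
(this file).  (B2) reduction to a representation whose endomorphism algebra
`{(X, Y) : X Ã = Ã Y}` is local (Fitting decomposition + irreducibility of `perm_m`, vzG Thm. 3.4).
(B3) ONE generic torus element `t = diag(p₁, …, p_m)` (distinct primes) and its lift `(P, Q)`
grade source and target `ℂⁿ` by `ℤ^m` through the generalised eigenspaces of `Q`, `P`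
(`P M = c M Q ⇒ M` maps the `β`-eigenspace of `Q` into the `cβ`-eigenspace of `P`), `Λ` in degree
`0`, the row-`i` part of `A₁` in degree `e_i`.  (B4) graded bookkeeping: the kernel degree `q`,
the cokernel degree `q + (1, …, 1)`, and for every `1 ≤ s ≤ m - 1` a source index of degree
`q + 𝟙_I` with `|I| = s` (block-rank counting).  (B5) the lifts of the permutations `σ ∈ 𝔖_m`
preserve the multiplicities of the degrees `q + 𝟙_I ↦ q + 𝟙_{σ I}` (trace argument in the local
endomorphism algebra).  (B6) hence all `2^m - 2` proper non-empty `I` occur: `n - 1 ≥ 2^m - 2`.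
This replaces the Levi–Malcev/central-torus machinery of LR17 §3.5–§6 by finite-dimensional
linear algebra; (B0) is the only input that is not elementary.

## References

* J. von zur Gathen, *Permanent and determinant*, Linear Algebra Appl. 96 (1987) 87–100:
  §2 (`sing D_n = {a : rank a ≤ n-2}`), Lemma 2.3, Thm. 3.1, Thm. 3.4.
* J. M. Landsberg, N. Ressayre, *Permanent v. determinant: an exponential lower bound assuming
  symmetry and a potential path towards Valiant's conjecture*, Differential Geom. Appl. 55 (2017)
  146–166, arXiv:1508.05788: Def. 1.2, Def. 2.12, Lemma 3.2, Lemma 3.3, §3.3.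
-/

noncomputable section

open Matrix MvPolynomial

namespace Literature.Computability.AlgebraicComplexity

/-! ### The constant part `Ã(0)` -/

section ConstPart

variable {k : Type*} [CommRing k] {σ : Type*} {ι : Type*}

/-- The constant part `Λ = Ã(0)` of a matrix `Ã = Λ + A` of polynomials (LR17 §1, §3:
`Ã = Λ + A` with `Λ ∈ M_n(ℂ)` constant and `A` linear). [cite: LandsbergRessayre2017, §3] -/
def constPart (A : Matrix ι ι (MvPolynomial σ k)) : Matrix ι ι k :=
  A.map constantCoeff

/-- Entries of the constant part. [cite: LandsbergRessayre2017, §3] -/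
@[simp] theorem constPart_apply (A : Matrix ι ι (MvPolynomial σ k)) (i j : ι) :
    constPart A i j = constantCoeff (A i j) := rfl

/-- `Λ = Ã(0)`: the constant part is the evaluation at the origin. [cite: LandsbergRessayre2017, §3] -/
theorem constPart_eq_map_eval_zero (A : Matrix ι ι (MvPolynomial σ k)) :
    constPart A = A.map (MvPolynomial.eval (0 : σ → k)) := by
  rw [MvPolynomial.eval_zero]; rfl

/-- The constant part of a constant matrix `M.map C` is `M`. [folklore] -/
@[simp] theorem constPart_map_C (M : Matrix ι ι k) :
    constPart (M.map (C : k →+* MvPolynomial σ k)) = M := by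
  ext i j; simp

/-- `constPart` is multiplicative (it is `RingHom.mapMatrix constantCoeff`). [folklore] -/
theorem constPart_mul [Fintype ι] (A B : Matrix ι ι (MvPolynomial σ k)) :
    constPart (A * B) = constPart A * constPart B :=
  Matrix.map_mul

/-- `det Ã(0) = (det Ã)(0)`. [folklore] -/
theorem det_constPart [Fintype ι] [DecidableEq ι] (A : Matrix ι ι (MvPolynomial σ k)) :
    (constPart A).det = constantCoeff A.det := by
  rw [RingHom.map_det]; rfl

variable [Fintype σ]

/-- A linear substitution of the variables does not change constant coefficients. [folklore] -/
theorem constantCoeff_linSubst (M : Matrix σ σ k) (p : MvPolynomial σ k) :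
    constantCoeff (linSubst σ k M p) = constantCoeff p := by
  have h1 : constantCoeff (linSubst σ k M p) = aeval (0 : σ → k) (linSubst σ k M p) := by
    simp
  rw [h1, linSubst, ← AlgHom.comp_apply, comp_aeval]
  simp

/-- Hence `(Ã(γ·x))(0) = Ã(0)`: substituting the variables leaves `Λ` unchanged.
[cite: LandsbergRessayre2017, §3] -/
@[simp] theorem constPart_linSubstEntries [DecidableEq σ] (γ : GL σ k)
    (A : Matrix ι ι (MvPolynomial σ k)) :
    constPart (Matrix.linSubstEntries γ A) = constPart A := by
  ext i j
  simp [Matrix.linSubstEntries, constantCoeff_linSubst]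

end ConstPart

/-! ### Lifts stabilise `Λ` (LR17 Def. 1.2 is automatic for exact lifts) -/

section Stabilise

variable {k : Type*} [CommRing k] {σ : Type*} [Fintype σ] [DecidableEq σ]
  {Γ : Subgroup (GL σ k)} {f : MvPolynomial σ k} {n : ℕ}
  {A : Matrix (Fin n) (Fin n) (MvPolynomial σ k)}

/-- If `Ã(γ·x) = g Ã(x) h⁻¹` exactly, then evaluating at `x = 0` gives `Λ = g Λ h⁻¹`, i.e. the lift
`(g, h)` lies in the stabiliser of `Λ` — the condition `g · Λ = Λ` built into LR17's group `𝔾_A`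
(Def. 1.2). [cite: LandsbergRessayre2017, Def. 1.2] -/
theorem constPart_eq_of_linSubstEntries_eq {γ : GL σ k} {g h : GL (Fin n) k}
    (hγ : Matrix.linSubstEntries γ A =
      (g : Matrix (Fin n) (Fin n) k).map C * A * ((h⁻¹ : GL (Fin n) k) : Matrix (Fin n) (Fin n) k).map C) :
    constPart A = (g : Matrix (Fin n) (Fin n) k) * constPart A * ((h⁻¹ : GL (Fin n) k) : Matrix _ _ k) := by
  have := congrArg constPart hγ
  rwa [constPart_linSubstEntries, constPart_mul, constPart_mul,
    constPart_map_C, constPart_map_C] at this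

/-- Equivalently `g Λ = Λ h`. [cite: LandsbergRessayre2017, Def. 1.2] -/
theorem mul_constPart_eq_of_linSubstEntries_eq {γ : GL σ k} {g h : GL (Fin n) k}
    (hγ : Matrix.linSubstEntries γ A =
      (g : Matrix (Fin n) (Fin n) k).map C * A * ((h⁻¹ : GL (Fin n) k) : Matrix (Fin n) (Fin n) k).map C) :
    (g : Matrix (Fin n) (Fin n) k) * constPart A = constPart A * (h : Matrix (Fin n) (Fin n) k) := by
  have e := constPart_eq_of_linSubstEntries_eq hγ
  have hh : ((h⁻¹ : GL (Fin n) k) : Matrix (Fin n) (Fin n) k) * (h : Matrix (Fin n) (Fin n) k) = 1 := by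
    rw [← Units.val_mul, inv_mul_cancel, Units.val_one]
  calc (g : Matrix (Fin n) (Fin n) k) * constPart A
      = (g : Matrix (Fin n) (Fin n) k) * constPart A * (((h⁻¹ : GL (Fin n) k) : Matrix _ _ k) * (h : Matrix _ _ k)) := by
        rw [hh, Matrix.mul_one]
    _ = constPart A * (h : Matrix (Fin n) (Fin n) k) := by rw [← Matrix.mul_assoc, ← e]

/-- For a `Γ`-equivariant representation (tree sense), every `γ ∈ Γ` has a lift `(g, h)` with
`Ã(γ·x) = g Ã(x) h⁻¹` AND `g Λ = Λ h` (LR17 Def. 1.2: `𝔾_A ⊆ Stab(Λ)`). [cite: LandsbergRessayre2017, Def. 1.2] -/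
theorem IsEquivariantDetRepr.exists_lift_stabilising (hA : IsEquivariantDetRepr Γ f A) {γ : GL σ k}
    (hγ : γ ∈ Γ) : ∃ g h : GL (Fin n) k,
      Matrix.linSubstEntries γ A =
        (g : Matrix (Fin n) (Fin n) k).map C * A * ((h⁻¹ : GL (Fin n) k) : Matrix (Fin n) (Fin n) k).map C ∧
      (g : Matrix (Fin n) (Fin n) k) * constPart A = constPart A * (h : Matrix (Fin n) (Fin n) k) := by
  obtain ⟨g, h, hgh⟩ := hA.2 γ hγ
  exact ⟨g, h, hgh, mul_constPart_eq_of_linSubstEntries_eq hgh⟩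

end Stabilise

/-! ### Regularity (LR17 Def. 2.12) and von zur Gathen's theorem (named fact) -/

section Regular

variable {k : Type*} [Field k] {σ : Type*}

/-- LR17 Def. 2.12: a determinantal representation `Ã : V → M_n` of `P` is **regular** if `Ã(0)` has
rank `n - 1`; here for affine representations in the tree's sense (`IsAffineDetRepr`).
[cite: LandsbergRessayre2017, Def. 2.12] -/
def IsRegularDetRepr (f : MvPolynomial σ k) {n : ℕ} (A : Matrix (Fin n) (Fin n) (MvPolynomial σ k)) :
    Prop :=
  IsAffineDetRepr f A ∧ (constPart A).rank = n - 1

/-- A regular representation is a representation. [cite: LandsbergRessayre2017, Def. 2.12] -/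
theorem IsRegularDetRepr.isAffineDetRepr {f : MvPolynomial σ k} {n : ℕ}
    {A : Matrix (Fin n) (Fin n) (MvPolynomial σ k)} (h : IsRegularDetRepr f A) :
    IsAffineDetRepr f A := h.1

/-- Over a field, a square matrix with `det = 0` has rank `< n`. [folklore] -/
theorem Matrix.rank_lt_card_of_det_eq_zero {ι : Type*} [Fintype ι] [DecidableEq ι]
    {M : Matrix ι ι k} (hM : M.det = 0) : M.rank < Fintype.card ι := by
  refine lt_of_le_of_ne (Matrix.rank_le_card_width M) fun hr => ?_
  have hsurj : Function.Surjective M.mulVec := by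
    have htop : LinearMap.range M.mulVecLin = ⊤ := by
      apply Submodule.eq_top_of_finrank_eq
      rw [Module.finrank_fintype_fun_eq_card]
      exact hr
    intro v
    have hv : v ∈ LinearMap.range M.mulVecLin := htop ▸ Submodule.mem_top
    obtain ⟨w, hw⟩ := hv
    exact ⟨w, hw⟩
  have hunit : IsUnit M := Matrix.mulVec_surjective_iff_isUnit.1 hsurj
  exact ((Matrix.isUnit_iff_isUnit_det M).1 hunit).ne_zero hM

/-- NAMED FACT (**von zur Gathen 1987, Thm. 3.1**, with §2: `sing D_n = {a : rank a ≤ n - 2}`;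
quoted in LR17 as Lemma 3.2 together with "`codim({perm_m = 0}_sing, ℂ^{m²}) ≥ 5`"): over an
infinite field `F` of characteristic `≠ 2`, for `m ≥ 3`, if `Ã : F^{m×m} → F^{n×n}` is a polynomial
map with `per x = det Ã(x)`, then `im Ã ∩ sing D_n = ∅`, i.e. `rank Ã(v) ≥ n - 1` for EVERY point
`v`.  Here `Ã` is a matrix of polynomials (no degree bound, as in the source) and `Ã(v)` is the
entrywise evaluation.  The printed proof is dimension theory (vzG Lemma 2.1: `sing D_n` irreducible
of dimension `n² - 4`; Lemma 2.3: every component of `sing P_m` has dimension `≤ m² - 5`; fibre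
dimension theorem) and is not vendored.  Users take `(h : vonzurGathen1987_perm_detRepr_rank)`.
[cite: Vonzurgathen1987, Thm. 3.1] -/
def vonzurGathen1987_perm_detRepr_rank : Prop :=
  ∀ (F : Type) [Field F] [Infinite F], (2 : F) ≠ 0 →
    ∀ m : ℕ, 3 ≤ m → ∀ (n : ℕ) (A : Matrix (Fin n) (Fin n) (MvPolynomial (Fin m × Fin m) F)),
      A.det = perPoly (Fin m) F → ∀ v : Fin m × Fin m → F, n ≤ (A.map (MvPolynomial.eval v)).rank + 1

/-- `perm_m` has no constant term (`m ≥ 1`). [folklore] -/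
theorem constantCoeff_perPoly (R : Type*) [CommRing R] {m : ℕ} (hm : 1 ≤ m) :
    constantCoeff (perPoly (Fin m) R) = 0 := by
  have h0 : (0 : Fin m → Fin m → R) = fun _ _ => 0 := rfl
  have : MvPolynomial.eval (0 : Fin m × Fin m → R) (perPoly (Fin m) R) = 0 := by
    rw [eval_perPoly]
    have hz : (Matrix.of fun i j : Fin m => (0 : Fin m × Fin m → R) (i, j)) = 0 := by
      ext i j; rfl
    rw [hz]
    haveI : Nonempty (Fin m) := ⟨⟨0, hm⟩⟩
    exact Matrix.permanent_zero
  rwa [MvPolynomial.eval_zero] at this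

/-- COROLLARY (LR17 §2.5/§3.3: "any determinantal representation of `perm_m` is regular", `m ≥ 3`):
granted von zur Gathen's theorem, every affine determinantal representation of `perm_m` over `ℂ`
has `rank Ã(0) = n - 1`. [cite: LandsbergRessayre2017, Lemma 3.2] -/
theorem isRegularDetRepr_perPoly (hvzg : vonzurGathen1987_perm_detRepr_rank) {m : ℕ} (hm : 3 ≤ m)
    {n : ℕ} {A : Matrix (Fin n) (Fin n) (MvPolynomial (Fin m × Fin m) ℂ)}
    (hA : IsAffineDetRepr (perPoly (Fin m) ℂ) A) : IsRegularDetRepr (perPoly (Fin m) ℂ) A := by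
  refine ⟨hA, ?_⟩
  have hge : n ≤ (constPart A).rank + 1 := by
    rw [constPart_eq_map_eval_zero]
    exact hvzg ℂ two_ne_zero m hm n A hA.2 0
  have hdet : (constPart A).det = 0 := by
    rw [det_constPart, hA.2, constantCoeff_perPoly ℂ (by omega)]
  have hlt := Matrix.rank_lt_card_of_det_eq_zero hdet
  rw [Fintype.card_fin] at hlt
  omega

/-- The same for an EQUIVARIANT representation (the case used for LR17 Thm. 2.8).
[cite: LandsbergRessayre2017, Lemma 3.2] -/
theorem IsEquivariantDetRepr.isRegular_perPoly (hvzg : vonzurGathen1987_perm_detRepr_rank) {m : ℕ}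
    (hm : 3 ≤ m) {Γ : Subgroup (GL (Fin m × Fin m) ℂ)} {n : ℕ}
    {A : Matrix (Fin n) (Fin n) (MvPolynomial (Fin m × Fin m) ℂ)}
    (hA : IsEquivariantDetRepr Γ (perPoly (Fin m) ℂ) A) : IsRegularDetRepr (perPoly (Fin m) ℂ) A :=
  isRegularDetRepr_perPoly hvzg hm hA.1

end Regular

/-! ### The normal form `Λ_{n-1}` and its stabiliser (LR17 Lemma 3.3) -/

section NormalForm

variable {k : Type*} {ι : Type*} [DecidableEq ι]

/-- `Λ_{i₀}`: the diagonal matrix with `0` at the distinguished index `i₀` and `1` elsewhere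
(LR17 §3.3: `Λ_{n-1}`, "1 in the `n-1` last diagonal entries and 0 elsewhere").
[cite: LandsbergRessayre2017, §3.3] -/
def lamMatrix (k : Type*) [Zero k] [One k] (i₀ : ι) : Matrix ι ι k :=
  Matrix.diagonal fun i => if i = i₀ then 0 else 1

/-- Entries of `Λ_{i₀}`. [cite: LandsbergRessayre2017, §3.3] -/
@[simp] theorem lamMatrix_apply [Zero k] [One k] (i₀ i j : ι) :
    lamMatrix k i₀ i j = if i = j then (if i = i₀ then 0 else 1) else 0 := by
  simp [lamMatrix, Matrix.diagonal_apply]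

variable [Fintype ι]

/-- **LR17 Lemma 3.3** (identity component, before dividing by the scalar): `P Λ_{i₀} = Λ_{i₀} Q`
iff, in the block decomposition `ι = {i₀} ⊔ ℍ`, `P = [[λ₂, 0], [v₂, g]]` and `Q = [[λ₁, φ₁], [0, g]]`
with the SAME block `g` on `ℍ`: the `i₀`-row of `P` and the `i₀`-column of `Q` vanish off the
diagonal and `P`, `Q` agree on `ℍ × ℍ`. [cite: LandsbergRessayre2017, Lemma 3.3] -/
theorem mul_lamMatrix_eq_lamMatrix_mul_iff [CommRing k] (i₀ : ι) (P Q : Matrix ι ι k) :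
    P * lamMatrix k i₀ = lamMatrix k i₀ * Q ↔
      (∀ j, j ≠ i₀ → P i₀ j = 0) ∧ (∀ i, i ≠ i₀ → Q i i₀ = 0) ∧
        ∀ i j, i ≠ i₀ → j ≠ i₀ → P i j = Q i j := by
  have key : ∀ i j, (P * lamMatrix k i₀) i j = (lamMatrix k i₀ * Q) i j ↔
      (if j = i₀ then (0 : k) else P i j) = if i = i₀ then 0 else Q i j := by
    intro i j
    simp only [lamMatrix, Matrix.mul_diagonal, Matrix.diagonal_mul, mul_ite, mul_zero, mul_one,
      ite_mul, zero_mul, one_mul]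
  constructor
  · intro h
    have h' : ∀ i j, (if j = i₀ then (0 : k) else P i j) = if i = i₀ then 0 else Q i j :=
      fun i j => (key i j).1 (by rw [h])
    refine ⟨fun j hj => ?_, fun i hi => ?_, fun i j hi hj => ?_⟩
    · simpa [hj] using h' i₀ j
    · simpa [hi] using (h' i i₀).symm
    · simpa [hi, hj] using h' i j
  · rintro ⟨hP, hQ, hPQ⟩
    ext i j
    rw [key]
    by_cases hj : j = i₀ <;> by_cases hi : i = i₀
    · simp [hi, hj]
    · subst hj; simp [hi, hQ i hi]
    · subst hi; simp [hj, hP j hj]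
    · simp [hi, hj, hPQ i j hi hj]

/-- The rank of `Λ_{i₀}` is `|ι| - 1`. [cite: LandsbergRessayre2017, §3.3] -/
theorem rank_lamMatrix [Field k] (i₀ : ι) : (lamMatrix k i₀).rank = Fintype.card ι - 1 := by
  classical
  rw [lamMatrix, Matrix.rank_diagonal]
  have : Fintype.card {i : ι // (if i = i₀ then (0 : k) else 1) ≠ 0} = Fintype.card {i : ι // i ≠ i₀} :=
    Fintype.card_congr (Equiv.subtypeEquivRight fun i => by by_cases h : i = i₀ <;> simp [h])
  rw [this, Fintype.card_subtype_compl, Fintype.card_subtype_eq]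

/-- **Normal form** (LR17 §3.3, last paragraph): a constant part of rank `n - 1` can be moved to
`Λ_{i₀}` by multiplying on the left and right by invertible constant matrices:
`V Λ U = Λ_{i₀}` for some `i₀`. [cite: LandsbergRessayre2017, §3.3] -/
theorem exists_mul_mul_eq_lamMatrix [Field k] (Λ : Matrix ι ι k)
    (hΛ : Λ.rank = Fintype.card ι - 1) (hι : 0 < Fintype.card ι) :
    ∃ (V U : Matrix ι ι k) (i₀ : ι), IsUnit V ∧ IsUnit U ∧ V * Λ * U = lamMatrix k i₀ := by
  classical
  obtain ⟨V, U, e, hV, hU, hVU⟩ := Matrix.exists_rank_normal_form Λ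
  have hc : Fintype.card ι - Λ.rank = 1 := by omega
  let z : Fin (Fintype.card ι - Λ.rank) := ⟨0, by omega⟩
  refine ⟨V, U, e.symm (Sum.inr z), hV, hU, ?_⟩
  rw [hVU]
  ext i j
  simp only [Matrix.submatrix_apply, lamMatrix_apply]
  rcases hei : e i with a | b <;> rcases hej : e j with c | d
  · simp only [Matrix.fromBlocks_apply₁₁, Matrix.one_apply]
    have hi : i ≠ e.symm (Sum.inr z) := by
      intro h; rw [h, Equiv.apply_symm_apply] at hei; cases hei
    by_cases hij : i = j
    · subst hij; rw [hei] at hej; cases hej; simp [hi]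
    · have : a ≠ c := fun h => hij (e.injective (by rw [hei, hej, h]))
      simp [this, hij]
  · simp only [Matrix.fromBlocks_apply₁₂, Matrix.zero_apply]
    have hij : i ≠ j := fun h => by subst h; rw [hei] at hej; cases hej
    simp [hij]
  · simp only [Matrix.fromBlocks_apply₂₁, Matrix.zero_apply]
    have hij : i ≠ j := fun h => by subst h; rw [hei] at hej; cases hej
    simp [hij]
  · simp only [Matrix.fromBlocks_apply₂₂, Matrix.zero_apply]
    have hb : b = z := Fin.ext (by have := b.2; omega)
    have hd : d = z := Fin.ext (by have := d.2; omega)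
    have hi : i = e.symm (Sum.inr z) := by rw [← hb, ← hei, Equiv.symm_apply_apply]
    have hj : j = e.symm (Sum.inr z) := by rw [← hd, ← hej, Equiv.symm_apply_apply]
    subst hi; subst hj; simp

/-- Hence (LR17 §3.3): for a REGULAR representation there are invertible constant matrices `V, U`
and an index `i₀` with `(V Ã U)(0) = Λ_{i₀}`; `V Ã U` is again an affine determinantal
representation of `det V · det U · f`. [cite: LandsbergRessayre2017, §3.3] -/
theorem IsRegularDetRepr.exists_normalForm [Field k] {σ : Type*} {f : MvPolynomial σ k} {n : ℕ}
    (hn : 0 < n) {A : Matrix (Fin n) (Fin n) (MvPolynomial σ k)} (hA : IsRegularDetRepr f A) :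
    ∃ (V U : Matrix (Fin n) (Fin n) k) (i₀ : Fin n), IsUnit V ∧ IsUnit U ∧
      constPart (V.map C * A * U.map C) = lamMatrix k i₀ := by
  obtain ⟨V, U, i₀, hV, hU, h⟩ :=
    exists_mul_mul_eq_lamMatrix (constPart A) (by rw [hA.2, Fintype.card_fin]) (by rwa [Fintype.card_fin])
  refine ⟨V, U, i₀, hV, hU, ?_⟩
  rw [constPart_mul, constPart_mul, constPart_map_C, constPart_map_C, h]

end NormalForm

end Literature.Computability.AlgebraicComplexity
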